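import Summits.QuantumFields.YangMills.Theorems.ToronValleyVolumeZeroModeLog4Rung
import HarnessLib

/-!
# The `k = 3` zero-mode block (commuting-TRIPLE quartic) is REGULAR, I: scaling representation and monotonicity of `β² Z₃(β)`
# (free-hands support of crux ⟨stmt-QuantumFields-24197⟩ `SwapVirialDeficit.SwapGluedStiffness`, LINE «sharp-sigma» of planner seat ym-idea-4:
# the σ-glued ring's zero-mode block is the commuting-triple quartic, «exponent 2, multiplicity 1, NO LOG» — the σ twin of the periodic
# `k = 4` block with ONE log, ✓`ToronValleyVolumeZeroModeLog4Rung.stub_rung_zeroModeLog4`)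

For the tree's Gaussian-regularised zero-mode partition function `Z_k(β) = ∫_{(ℝ³)ᵏ} exp(−β Q_k(c) − Σ_μ‖c_μ‖²/2) dc`
(✓`Cruxes.ToronTubeVolumeLaw.Birth.zeroModeZ`, `Q_k(c) = Σ_{μ<ν} ‖c_μ × c_ν‖²`) at `k = 3`:

* §1 `Q₃(snoc x a) = D(x₀,x₁) + Σ_μ D(x_μ,a)` and the integrand with the last column split off;
* §2 Tonelli split `∫_{(ℝ³)³} G = ∫ da ∫_{(ℝ³)²} G(snoc x a) dx`, the conditional integral `Ψ₃(β,a) = ∫ exp(−βQ₃(x,a) − (‖x‖²+‖a‖²)/2) dx`, its rotation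
  invariance `Ψ₃(β,a) = Ψ₃(β,‖a‖e₃)` and `Z₃(β) = ∫ Ψ₃(β,‖a‖e₃) da`;
* §3 the anisotropic rescaling `diag(β^{-1/2}, β^{-1/2}, 1)` of the two remaining columns (determinant `β⁻²`), under which
  `β²·Ψ₃(β, r e₃) = ∫ h_β(r,y) dy` with the RESCALED INTEGRAND
  `h_β(r,y) = exp(−[(y₀₀y₁₁−y₀₁y₁₀)²/β + cr(y₀,y₁) + r²(plSq y₀ + plSq y₁)] − [(plSq y₀ + plSq y₁)/β + y₀₂² + y₁₂² + r²]/2)`;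
* §4 ★ `h_β` is MONOTONE INCREASING in `β` with the `β`-free limit `h_∞(r,y)` (drop the two `1/β` terms), hence
  ★★ `zeroModeZ_three_sq_mul_monotoneOn`: `β ↦ β²·Z₃(β)` is monotone increasing on `(0,∞)` — the NO-LOG mechanism: after the blow-up of the
  4 normal directions of the commuting-triple cone the integrand converges MONOTONICALLY, so `β²Z₃(β) ↑ A₃ = ∫∫h_∞` (file II bounds it).

HONEST LABEL: finite-dimensional Laplace analysis toward a plan-level zero-mode rung of the DRAFT line «sharp-sigma»; nothing here is the fixed-`L` sharp
law, ⟨24197⟩, ⟨24194⟩ or any rung / summit statement; the Yang–Mills mass gap is NOT proved; no summit is proved by a line.  Width seat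
ym-line-sfw-p2-w3 g62 (cell ym-idea-1, free hands; own crux ⟨22884⟩ blocked-on ⟨19935⟩), `--supports stmt-QuantumFields-24197`.  Standard axioms, 0 `sorry`.
References: [cite: tHooft1979]; [cite: Vanbaal2001]; [folklore] (Laplace's method / monotone convergence).
-/

set_option autoImplicit false

noncomputable section

namespace Summit.QuantumFields.YangMills.Theorems.ToronValleyVolume.ZeroMode

open MeasureTheory Real Finset Set Filter
open scoped ENNReal Topology
open Summit.QuantumFields.YangMills.Cruxes.ToronTubeVolumeLaw.Birth

/-! ## §1 `k = 3`: splitting off the last column -/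

/-- `Q₂(x) = D(x₀,x₁)`. [folklore] -/
theorem quartic_two (x : Fin 2 → EuclideanSpace ℝ (Fin 3)) : zeroModeQuartic 2 x = pd (x 0) (x 1) := by
  rw [quartic_eq_half_sum, Fin.sum_univ_two, Fin.sum_univ_two, Fin.sum_univ_two, pd_self, pd_self, pd_comm (x 1) (x 0)]
  ring

/-- Splitting off the last column at `k = 3`: `Q₃(snoc x a) = D(x₀,x₁) + Σ_μ D(x_μ, a)`. [folklore] -/
theorem quartic_three_snoc (x : Fin 2 → EuclideanSpace ℝ (Fin 3)) (a : EuclideanSpace ℝ (Fin 3)) :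
    zeroModeQuartic 3 (Fin.snoc x a) = pd (x 0) (x 1) + ∑ μ, pd (x μ) a := by
  rw [quartic_eq_half_sum, ← quartic_two, quartic_eq_half_sum]
  simp_rw [Fin.sum_univ_castSucc (n := 2), Fin.snoc_castSucc, Fin.snoc_last, pd_self]
  have h : ∀ μ : Fin 2, pd a (x μ) = pd (x μ) a := fun μ => pd_comm _ _
  simp_rw [h, Finset.sum_add_distrib]
  ring

/-- Norm-sum splitting at `k = 3`: `Σ_{μ<3} ‖(snoc x a)_μ‖² = Σ_{μ<2} ‖x_μ‖² + ‖a‖²`. [folklore] -/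
theorem normSq_three_snoc (x : Fin 2 → EuclideanSpace ℝ (Fin 3)) (a : EuclideanSpace ℝ (Fin 3)) :
    ∑ μ : Fin 3, ‖(Fin.snoc x a : Fin 3 → EuclideanSpace ℝ (Fin 3)) μ‖ ^ 2 = (∑ μ : Fin 2, ‖x μ‖ ^ 2) + ‖a‖ ^ 2 := by
  rw [Fin.sum_univ_castSucc (n := 2)]
  simp_rw [Fin.snoc_castSucc, Fin.snoc_last]

/-- The `k = 3` integrand with the last column split off. [folklore] -/
theorem zmI_three_snoc (β : ℝ) (x : Fin 2 → EuclideanSpace ℝ (Fin 3)) (a : EuclideanSpace ℝ (Fin 3)) :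
    zmI 3 β (Fin.snoc x a) =
      Real.exp (-β * (pd (x 0) (x 1) + ∑ μ, pd (x μ) a) - ((∑ μ, ‖x μ‖ ^ 2) + ‖a‖ ^ 2) / 2) := by
  unfold zmI; rw [quartic_three_snoc, normSq_three_snoc]

/-- On the axis: `Σ_μ D(x_μ, r e₃) = r²(plSq x₀ + plSq x₁)`. [folklore] -/
theorem sum_two_pd_smul_e3 (x : Fin 2 → EuclideanSpace ℝ (Fin 3)) (r : ℝ) :
    ∑ μ, pd (x μ) (r • e3) = r ^ 2 * (plSq (x 0) + plSq (x 1)) := by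
  rw [Fin.sum_univ_two, pd_smul_e3, pd_smul_e3]; ring

/-! ## §2 Tonelli split, the conditional integral `Ψ₃`, rotation onto the axis -/

/-- `(a, x) ↦ snoc x a` is the inverse of the measurable splitting equivalence at the last index of `Fin 3`. [folklore] -/
theorem snoc2_eq_piFinSuccAbove_symm :
    (fun p : EuclideanSpace ℝ (Fin 3) × (Fin 2 → EuclideanSpace ℝ (Fin 3)) =>
      (Fin.snoc p.2 p.1 : Fin 3 → EuclideanSpace ℝ (Fin 3))) =
      ⇑(MeasurableEquiv.piFinSuccAbove (fun _ : Fin 3 => EuclideanSpace ℝ (Fin 3)) (Fin.last 2)).symm := by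
  funext p
  rw [MeasurableEquiv.piFinSuccAbove_symm_apply]
  exact (Fin.insertNth_last' p.1 p.2).symm

/-- `(a, x) ↦ snoc x a` is measurable (`k = 3`). [folklore] -/
theorem measurable_snoc2_pair :
    Measurable (fun p : EuclideanSpace ℝ (Fin 3) × (Fin 2 → EuclideanSpace ℝ (Fin 3)) =>
      (Fin.snoc p.2 p.1 : Fin 3 → EuclideanSpace ℝ (Fin 3))) := by
  rw [snoc2_eq_piFinSuccAbove_symm]; exact MeasurableEquiv.measurable _

/-- Change of variables `c = snoc x a` for a lower integral on `(ℝ³)³`, then Tonelli. [folklore] -/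
theorem lintegral_eq_lintegral_snoc2 (G : (Fin 3 → EuclideanSpace ℝ (Fin 3)) → ℝ≥0∞) (hG : Measurable G) :
    ∫⁻ c, G c = ∫⁻ a : EuclideanSpace ℝ (Fin 3), ∫⁻ x : Fin 2 → EuclideanSpace ℝ (Fin 3), G (Fin.snoc x a) := by
  have hp := (volume_preserving_piFinSuccAbove (fun _ : Fin 3 => EuclideanSpace ℝ (Fin 3)) (Fin.last 2)).symm
  rw [← hp.lintegral_comp hG, ← snoc2_eq_piFinSuccAbove_symm, Measure.volume_eq_prod, lintegral_prod]
  exact (hG.comp measurable_snoc2_pair).aemeasurable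

/-- The CONDITIONAL INTEGRAL `Ψ₃(β,a) = ∫_{(ℝ³)²} exp(−βQ₃(x₀,x₁,a) − (‖x₀‖²+‖x₁‖²+‖a‖²)/2) dx` (no box restriction). -/
def Psi3 (β : ℝ) (a : EuclideanSpace ℝ (Fin 3)) : ℝ≥0∞ :=
  ∫⁻ x : Fin 2 → EuclideanSpace ℝ (Fin 3), ENNReal.ofReal (zmI 3 β (Fin.snoc x a))

/-- `∫ F₃ = ∫ Ψ₃(β,a) da`. [folklore] -/
theorem lintegral_zmI_three_eq (β : ℝ) :
    ∫⁻ c, ENNReal.ofReal (zmI 3 β c) = ∫⁻ a, Psi3 β a :=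
  lintegral_eq_lintegral_snoc2 _ (ENNReal.measurable_ofReal.comp (measurable_zmI 3 β))

/-- A linear isometry applied to both columns is measure preserving on `(ℝ³)²`. [folklore] -/
theorem measurePreserving_columns2 (R : EuclideanSpace ℝ (Fin 3) ≃ₗᵢ[ℝ] EuclideanSpace ℝ (Fin 3)) :
    MeasurePreserving (fun (x : Fin 2 → EuclideanSpace ℝ (Fin 3)) (μ : Fin 2) => R (x μ)) volume volume := by
  have h := measurePreserving_pi (fun _ : Fin 2 => (volume : Measure (EuclideanSpace ℝ (Fin 3))))
    (fun _ => (volume : Measure (EuclideanSpace ℝ (Fin 3)))) (f := fun _ => R) (fun _ => R.measurePreserving)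
  exact h

/-- ROTATION INVARIANCE: `Ψ₃(β, a) = Ψ₃(β, R a)` for a linear isometry `R`. [folklore] -/
theorem Psi3_map (β : ℝ) (R : EuclideanSpace ℝ (Fin 3) ≃ₗᵢ[ℝ] EuclideanSpace ℝ (Fin 3)) (a : EuclideanSpace ℝ (Fin 3)) :
    Psi3 β a = Psi3 β (R a) := by
  unfold Psi3
  have hmeas : Measurable (fun x : Fin 2 → EuclideanSpace ℝ (Fin 3) => ENNReal.ofReal (zmI 3 β (Fin.snoc x (R a)))) :=
    ENNReal.measurable_ofReal.comp ((measurable_zmI 3 β).comp (measurable_snoc2_pair.comp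
      (measurable_const.prodMk measurable_id)))
  rw [← (measurePreserving_columns2 R).lintegral_comp hmeas]
  refine lintegral_congr fun x => ?_
  show ENNReal.ofReal (zmI 3 β (Fin.snoc x a)) = ENNReal.ofReal (zmI 3 β (Fin.snoc (fun μ => R (x μ)) (R a)))
  rw [show (Fin.snoc (fun μ => R (x μ)) (R a) : Fin 3 → EuclideanSpace ℝ (Fin 3)) =
      fun μ => R ((Fin.snoc x a : Fin 3 → EuclideanSpace ℝ (Fin 3)) μ) from (Fin.comp_snoc R x a).symm, zmI_map]

/-- `Ψ₃(β,a) = Ψ₃(β, ‖a‖e₃)`. [folklore] -/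
theorem Psi3_eq_axis (β : ℝ) (a : EuclideanSpace ℝ (Fin 3)) : Psi3 β a = Psi3 β (‖a‖ • e3) := by
  obtain ⟨R, hR⟩ := exists_isometry_map_eq_smul_e3 a
  rw [Psi3_map β R a, hR]

/-- `Z₃(β) = ∫ Ψ₃(β, ‖a‖e₃) da` (as a lower integral, `β ≥ 0`). [folklore] -/
theorem ofReal_zeroModeZ_three {β : ℝ} (hβ : 0 ≤ β) :
    ENNReal.ofReal (zeroModeZ 3 β) = ∫⁻ a : EuclideanSpace ℝ (Fin 3), Psi3 β (‖a‖ • e3) := by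
  rw [ofReal_zeroModeZ 3 hβ, lintegral_zmI_three_eq]
  exact lintegral_congr fun a => Psi3_eq_axis β a

/-! ## §3 Anisotropic rescaling of the two remaining columns -/

/-- The rescaling `diag(s,s,t)` applied to both columns of `(ℝ³)²`. -/
def Lam2 (s t : ℝ) : (Fin 2 → EuclideanSpace ℝ (Fin 3)) →ₗ[ℝ] (Fin 2 → EuclideanSpace ℝ (Fin 3)) :=
  LinearMap.pi (fun μ => diag3 s t ∘ₗ LinearMap.proj μ)

/-- Auxiliary: `Lam2_apply`. -/
@[simp] theorem Lam2_apply (s t : ℝ) (x : Fin 2 → EuclideanSpace ℝ (Fin 3)) (μ : Fin 2) :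
    Lam2 s t x μ = diag3 s t (x μ) := by simp [Lam2]

/-- `det Λ₂(s,t) = (s² t)²`. [folklore] -/
theorem det_Lam2 (s t : ℝ) : LinearMap.det (Lam2 s t) = (s * s * t) ^ 2 := by
  unfold Lam2; rw [LinearMap.det_pi]; simp [det_diag3]

/-- CHANGE OF VARIABLES under `Λ₂(s,t)` (`s, t ≠ 0`): `∫ g(Λ₂y) dy = |det Λ₂|⁻¹ ∫ g`. [folklore] -/
theorem lintegral_comp_Lam2 {s t : ℝ} (hs : s ≠ 0) (ht : t ≠ 0)
    (g : (Fin 2 → EuclideanSpace ℝ (Fin 3)) → ℝ≥0∞) (hg : Measurable g) :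
    ∫⁻ y, g (Lam2 s t y) = ENNReal.ofReal (|(s * s * t) ^ 2|⁻¹) * ∫⁻ y, g y := by
  have hdet : LinearMap.det (Lam2 s t) ≠ 0 := by rw [det_Lam2]; positivity
  have hΛ : Measurable (Lam2 s t) := (LinearMap.continuous_of_finiteDimensional _).measurable
  rw [← lintegral_map hg hΛ, Measure.map_linearMap_addHaar_eq_smul_addHaar _ hdet, lintegral_smul_measure,
    det_Lam2, smul_eq_mul, abs_inv]

/-- The RESCALED INTEGRAND
`h_β(r,y) = exp(−[(y₀₀y₁₁−y₀₁y₁₀)²/β + cr(y₀,y₁) + r²(plSq y₀ + plSq y₁)] − [(plSq y₀ + plSq y₁)/β + y₀₂² + y₁₂² + r²]/2)`. -/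
def hsc (β r : ℝ) (y : Fin 2 → EuclideanSpace ℝ (Fin 3)) : ℝ :=
  Real.exp (-((y 0 0 * y 1 1 - y 0 1 * y 1 0) ^ 2 / β + cr (y 0) (y 1) + r ^ 2 * (plSq (y 0) + plSq (y 1)))
    - ((plSq (y 0) + plSq (y 1)) / β + (y 0 2) ^ 2 + (y 1 2) ^ 2 + r ^ 2) / 2)

/-- The `β = ∞` LIMIT INTEGRAND `h_∞(r,y) = exp(−[cr(y₀,y₁) + r²(plSq y₀ + plSq y₁)] − [y₀₂² + y₁₂² + r²]/2)`
(a Gaussian on the 4-dimensional normal space of the commuting-triple cone, coupled through the axial coordinates). -/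
def hlim (r : ℝ) (y : Fin 2 → EuclideanSpace ℝ (Fin 3)) : ℝ :=
  Real.exp (-(cr (y 0) (y 1) + r ^ 2 * (plSq (y 0) + plSq (y 1))) - ((y 0 2) ^ 2 + (y 1 2) ^ 2 + r ^ 2) / 2)

/-- Auxiliary: `hsc_pos`. -/
theorem hsc_pos (β r : ℝ) (y : Fin 2 → EuclideanSpace ℝ (Fin 3)) : 0 < hsc β r y := Real.exp_pos _

/-- Auxiliary: `hlim_pos`. -/
theorem hlim_pos (r : ℝ) (y : Fin 2 → EuclideanSpace ℝ (Fin 3)) : 0 < hlim r y := Real.exp_pos _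

/-- Auxiliary: `continuous_hsc`. -/
theorem continuous_hsc (β r : ℝ) : Continuous (hsc β r) := by
  unfold hsc cr plSq
  fun_prop

/-- Auxiliary: `measurable_hsc`. -/
theorem measurable_hsc (β r : ℝ) : Measurable (hsc β r) := (continuous_hsc β r).measurable

/-- Auxiliary: `continuous_hlim`. -/
theorem continuous_hlim (r : ℝ) : Continuous (hlim r) := by
  unfold hlim cr plSq
  fun_prop

/-- Auxiliary: `measurable_hlim`. -/
theorem measurable_hlim (r : ℝ) : Measurable (hlim r) := (continuous_hlim r).measurable

/-- KEY ALGEBRA: under `x = Λ₂(β^{-1/2}, 1)·y` the integrand on the axis IS the rescaled integrand: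
`exp(−βQ₃(x₀,x₁,re₃) − (‖x‖² + r²)/2) = h_β(r, y)` (`β > 0`). [folklore] -/
theorem zmI_three_snoc_Lam2 {β : ℝ} (hβ : 0 < β) (r : ℝ) (y : Fin 2 → EuclideanSpace ℝ (Fin 3)) :
    zmI 3 β (Fin.snoc (Lam2 (Real.sqrt β)⁻¹ 1 y) (r • e3)) = hsc β r y := by
  rw [zmI_three_snoc, sum_two_pd_smul_e3, pd_eq_coord, Fin.sum_univ_two,
    show ‖r • e3‖ ^ 2 = r ^ 2 by rw [norm_smul, norm_e3, mul_one, Real.norm_eq_abs, sq_abs]]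
  rw [normSq_eq_plSq_add ((Lam2 (Real.sqrt β)⁻¹ 1 y) 0), normSq_eq_plSq_add ((Lam2 (Real.sqrt β)⁻¹ 1 y) 1)]
  simp only [Lam2_apply, cr_diag3, plSq_diag3, diag3_apply_zero, diag3_apply_one, diag3_apply_two, one_mul, one_pow,
    mul_one]
  unfold hsc
  have hs2 : ((Real.sqrt β)⁻¹) ^ 2 = β⁻¹ := by rw [inv_pow, Real.sq_sqrt hβ.le]
  have hβ0 : β ≠ 0 := hβ.ne'
  congr 1
  rw [show ((Real.sqrt β)⁻¹ * y 0 0 * ((Real.sqrt β)⁻¹ * y 1 1) - (Real.sqrt β)⁻¹ * y 0 1 * ((Real.sqrt β)⁻¹ * y 1 0)) ^ 2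
      = (((Real.sqrt β)⁻¹) ^ 2) ^ 2 * (y 0 0 * y 1 1 - y 0 1 * y 1 0) ^ 2 by ring, hs2]
  field_simp
  ring

/-- ★ SCALING REPRESENTATION on the axis: `β²·Ψ₃(β, r e₃) = ∫ h_β(r,y) dy` (`β > 0`). [folklore] -/
theorem lintegral_hsc_eq {β : ℝ} (hβ : 0 < β) (r : ℝ) :
    ∫⁻ y, ENNReal.ofReal (hsc β r y) = ENNReal.ofReal (β ^ 2) * Psi3 β (r • e3) := by
  have hs : (Real.sqrt β)⁻¹ ≠ 0 := inv_ne_zero (Real.sqrt_pos.2 hβ).ne'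
  have hg : Measurable (fun x : Fin 2 → EuclideanSpace ℝ (Fin 3) => ENNReal.ofReal (zmI 3 β (Fin.snoc x (r • e3)))) :=
    ENNReal.measurable_ofReal.comp ((measurable_zmI 3 β).comp (measurable_snoc2_pair.comp
      (measurable_const.prodMk measurable_id)))
  have h := lintegral_comp_Lam2 hs one_ne_zero _ hg
  simp only [mul_one] at h
  have hdet : |((Real.sqrt β)⁻¹ * (Real.sqrt β)⁻¹) ^ 2|⁻¹ = β ^ 2 := by
    rw [← mul_inv, Real.mul_self_sqrt hβ.le, inv_pow, abs_inv, abs_of_nonneg (pow_nonneg hβ.le 2), inv_inv]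
  unfold Psi3
  rw [← hdet, ← h]
  exact lintegral_congr fun y => by rw [zmI_three_snoc_Lam2 hβ]

/-- ★ `β²·Z₃(β) = ∫ da ∫ dy h_β(‖a‖, y)` (`β > 0`). [folklore] -/
theorem ofReal_sq_mul_zeroModeZ_three {β : ℝ} (hβ : 0 < β) :
    ENNReal.ofReal (β ^ 2 * zeroModeZ 3 β) = ∫⁻ a : EuclideanSpace ℝ (Fin 3), ∫⁻ y, ENNReal.ofReal (hsc β ‖a‖ y) := by
  rw [ENNReal.ofReal_mul (sq_nonneg β), ofReal_zeroModeZ_three hβ.le, ← lintegral_const_mul' _ _ ENNReal.ofReal_ne_top]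
  exact lintegral_congr fun a => (lintegral_hsc_eq hβ ‖a‖).symm

/-! ## §4 Monotonicity in `β` -/

/-- ★ The rescaled integrand is MONOTONE INCREASING in `β` on `(0,∞)`. [folklore] -/
theorem hsc_mono {β β' : ℝ} (hβ : 0 < β) (hββ' : β ≤ β') (r : ℝ) (y : Fin 2 → EuclideanSpace ℝ (Fin 3)) :
    hsc β r y ≤ hsc β' r y := by
  unfold hsc
  refine Real.exp_le_exp.2 ?_
  have hD : 0 ≤ (y 0 0 * y 1 1 - y 0 1 * y 1 0) ^ 2 := sq_nonneg _
  have hP : 0 ≤ plSq (y 0) + plSq (y 1) := add_nonneg (plSq_nonneg _) (plSq_nonneg _)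
  have h1 : (y 0 0 * y 1 1 - y 0 1 * y 1 0) ^ 2 / β' ≤ (y 0 0 * y 1 1 - y 0 1 * y 1 0) ^ 2 / β :=
    div_le_div_of_nonneg_left hD hβ hββ'
  have h2 : (plSq (y 0) + plSq (y 1)) / β' ≤ (plSq (y 0) + plSq (y 1)) / β := div_le_div_of_nonneg_left hP hβ hββ'
  linarith

/-- The rescaled integrand is dominated by its `β = ∞` limit. [folklore] -/
theorem hsc_le_hlim {β : ℝ} (hβ : 0 < β) (r : ℝ) (y : Fin 2 → EuclideanSpace ℝ (Fin 3)) : hsc β r y ≤ hlim r y := by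
  unfold hsc hlim
  refine Real.exp_le_exp.2 ?_
  have h1 : 0 ≤ (y 0 0 * y 1 1 - y 0 1 * y 1 0) ^ 2 / β := div_nonneg (sq_nonneg _) hβ.le
  have h2 : 0 ≤ (plSq (y 0) + plSq (y 1)) / β := div_nonneg (add_nonneg (plSq_nonneg _) (plSq_nonneg _)) hβ.le
  linarith

/-- Pointwise convergence `h_β(r,y) → h_∞(r,y)` as `β → ∞`. [folklore] -/
theorem tendsto_hsc (r : ℝ) (y : Fin 2 → EuclideanSpace ℝ (Fin 3)) :
    Tendsto (fun β => hsc β r y) atTop (𝓝 (hlim r y)) := by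
  unfold hsc hlim
  refine (Real.continuous_exp.tendsto _).comp ?_
  have h1 : Tendsto (fun β : ℝ => (y 0 0 * y 1 1 - y 0 1 * y 1 0) ^ 2 / β) atTop (𝓝 0) :=
    tendsto_const_nhds.div_atTop tendsto_id
  have h2 : Tendsto (fun β : ℝ => (plSq (y 0) + plSq (y 1)) / β) atTop (𝓝 0) := tendsto_const_nhds.div_atTop tendsto_id
  have e : -(cr (y 0) (y 1) + r ^ 2 * (plSq (y 0) + plSq (y 1))) - ((y 0 2) ^ 2 + (y 1 2) ^ 2 + r ^ 2) / 2
      = -(0 + cr (y 0) (y 1) + r ^ 2 * (plSq (y 0) + plSq (y 1))) - (0 + (y 0 2) ^ 2 + (y 1 2) ^ 2 + r ^ 2) / 2 := by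
    ring
  rw [e]
  exact ((h1.add tendsto_const_nhds).add tendsto_const_nhds).neg.sub
    ((((h2.add tendsto_const_nhds).add tendsto_const_nhds).add tendsto_const_nhds).div_const 2)

/-- ★★ **`β ↦ β²·Z₃(β)` IS MONOTONE INCREASING ON `(0,∞)`** — the no-log mechanism of the `k = 3` block. [folklore] -/
theorem zeroModeZ_three_sq_mul_monotoneOn :
    MonotoneOn (fun β : ℝ => β ^ 2 * zeroModeZ 3 β) (Ioi 0) := by
  intro β hβ β' hβ' hle
  rw [Set.mem_Ioi] at hβ hβ'
  have h : ENNReal.ofReal (β ^ 2 * zeroModeZ 3 β) ≤ ENNReal.ofReal (β' ^ 2 * zeroModeZ 3 β') := by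
    rw [ofReal_sq_mul_zeroModeZ_three hβ, ofReal_sq_mul_zeroModeZ_three hβ']
    exact lintegral_mono fun a => lintegral_mono fun y => ENNReal.ofReal_le_ofReal (hsc_mono hβ hle ‖a‖ y)
  exact (ENNReal.ofReal_le_ofReal_iff (mul_nonneg (sq_nonneg _) (zeroModeZ_nonneg 3 β'))).1 h

end Summit.QuantumFields.YangMills.Theorems.ToronValleyVolume.ZeroMode

end
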